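import Summits.CriticalPhenomena.PercolationContinuityZ3.Theses.PercNearOneGluing
import Summits.CriticalPhenomena.PercolationContinuityZ3.Theorems.PercNearOneGluingAdditiveGluingEdgeAffine
import Summits.CriticalPhenomena.PercolationContinuityZ3.Theorems.PercNearOneGluingAdditiveGluingGlueReach
import Summits.CriticalPhenomena.PercolationContinuityZ3.Theorems.PercNearOneGluingAdditiveGluingKnThm1Set
import Summits.CriticalPhenomena.PercolationContinuityZ3.Theorems.PercNearOneGluingAdditiveGluingTieLiftOne
import Literature.Probability.Percolation.PercolationProofs
import HarnessLib

/-!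
# Crux `PercNearOneGluing.AdditiveGluing` (stmt-CriticalPhenomena-4576), line `replica-splice-at-entrance` —
# stub `stub_tieLiftTwo`, auxiliary file: two-bond decomposition and the convexity step

Helper file for the crux (lead prover-line-stmt-CriticalPhenomena-4576-c3); lands with
`--supports stmt-CriticalPhenomena-4576`; it does NOT close the crux.  It carries the measure-theoretic
half of the second tie reduction (`…TieLiftTwo.lean`: "if additive gluing holds whenever THREE distinct
relays attain the slack exactly, it holds whenever TWO do"), for the joint lift of the two pairs
`e₀ = s(a₀, b)`, `e₁ = s(a₁, b)` of a finite weighted graph `(Fin n, w)`, `P_w = prodBernoulli w`.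

## Content

* `tieLiftTwo_twoBond_decomp`: `P_{w[e₀↦p][e₁↦q]}(S)` is bi-affine in `(p, q)` with the four corner
  measures `P_{w[e₀↦i][e₁↦j]}`, `i, j ∈ {0,1}` (the landed one-bond decomposition `stub_oneBondDecomp_k15`
  twice).
* `tieLiftTwo_real_update_one`: `P_{v[e↦1]}(S) = P_v((insert e)⁻¹' S)` (`goodStepEI_prodBernoulli_map_insert`,
  `tieLiftOne_measurable_insert` of the landed sibling file `…TieLiftOne.lean`),
  and reachability after inserting one pair `s(c, d)` (`tieLiftTwo_reach_insert`, from
  `glueReach_walk_split` / `glueReach_of_split`), with the resulting preimages of `{x ↔ b}` and `{o ↔ A}`.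
* `tieLiftTwo_Eform`: the two-relay gluing inequality in "E-form",
  `P((o↔a₀ ∪ o↔a₁) ∖ o↔b) ≤ P(a₀ ↮ b)` when `P(a₀ ↔ b) ≤ P(a₁ ↔ b)` — Kozma–Nitzan arXiv:2401.12397 Thm 1
  (the landed `stub_knThm1Set` with observer set `{o}`).
* `tieLiftTwo_convex_step`: for `Ψ(v) := P_v(o ↔ A) − P_v(o ↔ b) − P_v(a₀ ↮ b)` and tied relays
  `P_v(a₀ ↔ b) ≤ P_v(a₁ ↔ b)`: `2 Ψ(v) ≤ Ψ(v[e₀↦1]) + Ψ(v[e₁↦1])` (the sign of `Ψ'` along the joint lift).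
* `tieLiftTwo_tie_linear`: `F₀ − F₁` is linear along the lift:
  `(1 − P_{w[e₀↦p][e₁↦q]}(a₀↔b)) − (1 − P_{w[e₀↦p][e₁↦q]}(a₁↔b)) = (1−p) K₀ − (1−q) K₁`.
* `tieLiftTwo_psi_decomp`: `Ψ(w[e₀↦p][e₁↦q])` is bi-affine in `(p, q)`.
* `stub_tieLiftTwoConvex`: the registered helper stub (= `tieLiftTwo_convex_step`, binders explicit).
-/

namespace Summit.CriticalPhenomena.PercolationContinuityZ3.Theorems

open MeasureTheory Set
open Literature.Probability.LatticeModels Literature.Probability.Percolation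

noncomputable section

variable {n : ℕ}

/-! ### Two-bond decomposition -/

/-- **Two-bond decomposition**: for distinct pairs `e₀ ≠ e₁`, `P_{w[e₀↦p][e₁↦q]}(S)` is bi-affine in
`(p, q)`, with the four corner measures `P_{w[e₀↦i][e₁↦j]}(S)`, `i, j ∈ {0, 1}`, as coefficients
(the one-bond decomposition `stub_oneBondDecomp_k15` applied along `e₁` and then along `e₀`). [folklore] -/
theorem tieLiftTwo_twoBond_decomp (w : Sym2 (Fin n) → unitInterval) {e₀ e₁ : Sym2 (Fin n)}
    (hne : e₀ ≠ e₁) (p q : unitInterval) (S : Set (BondConfig (Fin n))) :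
    (prodBernoulli (Function.update (Function.update w e₀ p) e₁ q)).real S =
      (1 - (p : ℝ)) * (1 - (q : ℝ)) *
          (prodBernoulli (Function.update (Function.update w e₀ 0) e₁ 0)).real S +
        (p : ℝ) * (1 - (q : ℝ)) *
          (prodBernoulli (Function.update (Function.update w e₀ 1) e₁ 0)).real S +
        (1 - (p : ℝ)) * (q : ℝ) *
          (prodBernoulli (Function.update (Function.update w e₀ 0) e₁ 1)).real S +
        (p : ℝ) * (q : ℝ) *
          (prodBernoulli (Function.update (Function.update w e₀ 1) e₁ 1)).real S := by
  -- along `e₀`, at a fixed value `r` of `e₁`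
  have h0 : ∀ r : unitInterval,
      (prodBernoulli (Function.update (Function.update w e₀ p) e₁ r)).real S =
        (1 - (p : ℝ)) * (prodBernoulli (Function.update (Function.update w e₀ 0) e₁ r)).real S +
          (p : ℝ) * (prodBernoulli (Function.update (Function.update w e₀ 1) e₁ r)).real S := by
    intro r
    have h := stub_oneBondDecomp_k15 n (Function.update (Function.update w e₀ p) e₁ r) e₀ S
    rw [Function.update_of_ne hne, Function.update_self] at h
    simpa only [Function.update_comm (Ne.symm hne), Function.update_idem] using h
  -- along `e₁`
  have h1 := stub_oneBondDecomp_k15 n (Function.update (Function.update w e₀ p) e₁ q) e₁ S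
  simp only [Function.update_self, Function.update_idem] at h1
  rw [h1, h0 0, h0 1]
  ring

/-! ### Opening one pair: pushforward under `insert` and reachability -/

/-- `P_{v[e↦1]}(S) = P_v((insert e)⁻¹' S)`: opening the pair `e` almost surely is the pushforward of `P_v`
under `ω ↦ insert e ω` (`goodStepEI_prodBernoulli_map_insert`). [folklore] -/
theorem tieLiftTwo_real_update_one (v : Sym2 (Fin n) → unitInterval) (e : Sym2 (Fin n))
    (S : Set (BondConfig (Fin n))) :
    (prodBernoulli (Function.update v e 1)).real S =
      (prodBernoulli v).real ((fun ω : BondConfig (Fin n) => insert e ω) ⁻¹' S) := by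
  rw [← map_measureReal_apply (tieLiftOne_measurable_insert e) MeasurableSet.of_discrete,
    goodStepEI_prodBernoulli_map_insert]

/-- If the pair `s(a, b)` (`a ≠ b`) has weight `1` then `a ↔ b` almost surely. [folklore] -/
theorem tieLiftTwo_real_conn_eq_one (v : Sym2 (Fin n) → unitInterval) {a b : Fin n} (hab : a ≠ b)
    (hv : v s(a, b) = 1) : (prodBernoulli v).real (openConn a b) = 1 := by
  have h : Function.update v s(a, b) 1 = v := by rw [← hv, Function.update_eq_self]
  calc (prodBernoulli v).real (openConn a b)
      = (prodBernoulli (Function.update v s(a, b) 1)).real (openConn a b) := by rw [h]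
    _ = 1 := tieLiftOne_real_one_conn v hab

/-- **Reachability after inserting one pair** `s(c, d)`, `c ≠ d`: `x ↔ y` in `insert s(c,d) ω` iff
`x ↔ y` in `ω`, or `x` reaches `c` or `d` and `y` is reached from `c` or `d` in `ω`
(`glueReach_walk_split` / `glueReach_of_split` with the glued set `{c, d}`). [folklore] -/
theorem tieLiftTwo_reach_insert (ω : BondConfig (Fin n)) {c d : Fin n} (hcd : c ≠ d) (x y : Fin n) :
    (openGraph (insert s(c, d) ω)).Reachable x y ↔
      (openGraph ω).Reachable x y ∨
        (((openGraph ω).Reachable x c ∨ (openGraph ω).Reachable x d) ∧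
          ((openGraph ω).Reachable c y ∨ (openGraph ω).Reachable d y)) := by
  classical
  have hHG : ∀ u v : Fin n, (openGraph (insert s(c, d) ω)).Adj u v →
      (openGraph ω).Adj u v ∨ (u ∈ ({c, d} : Finset (Fin n)) ∧ v ∈ ({c, d} : Finset (Fin n))) := by
    intro u v huv
    rw [openGraph_adj, Set.mem_insert_iff] at huv
    obtain ⟨h | h, hne⟩ := huv
    · right
      rw [Sym2.eq_iff] at h
      rcases h with ⟨h1, h2⟩ | ⟨h1, h2⟩ <;> subst h1 <;> subst h2 <;> simp
    · exact Or.inl ((openGraph_adj ω u v).2 ⟨h, hne⟩)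
  have hGH : openGraph ω ≤ openGraph (insert s(c, d) ω) := by
    intro u v huv
    rw [openGraph_adj] at huv ⊢
    exact ⟨Set.mem_insert_of_mem _ huv.1, huv.2⟩
  have hSS : ∀ u v : Fin n, u ∈ ({c, d} : Finset (Fin n)) → v ∈ ({c, d} : Finset (Fin n)) → u ≠ v →
      (openGraph (insert s(c, d) ω)).Adj u v := by
    intro u v hu hv huv
    rw [openGraph_adj]
    refine ⟨?_, huv⟩
    rw [Finset.mem_insert, Finset.mem_singleton] at hu hv
    rcases hu with rfl | rfl <;> rcases hv with rfl | rfl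
    · exact absurd rfl huv
    · exact Set.mem_insert _ _
    · rw [Sym2.eq_swap]; exact Set.mem_insert _ _
    · exact absurd rfl huv
  constructor
  · rintro ⟨wk⟩
    have h := glueReach_walk_split hHG wk
    simpa only [Finset.mem_insert, Finset.mem_singleton, or_and_right, exists_or, exists_eq_left] using h
  · intro h
    refine glueReach_of_split hGH hSS ?_
    simpa only [Finset.mem_insert, Finset.mem_singleton, or_and_right, exists_or, exists_eq_left] using h

/-- Inserting `s(c, b)` (`c ≠ b`): `x ↔ b` afterwards iff `x ↔ b` or `x ↔ c` before. [folklore] -/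
theorem tieLiftTwo_preimage_conn (c b x : Fin n) (hcb : c ≠ b) :
    (fun ω : BondConfig (Fin n) => insert s(c, b) ω) ⁻¹' (openConn x b : Set (BondConfig (Fin n))) =
      openConn x b ∪ openConn x c := by
  ext ω
  simp only [Set.mem_preimage, Set.mem_union]
  show (openGraph (insert s(c, b) ω)).Reachable x b ↔
    (openGraph ω).Reachable x b ∨ (openGraph ω).Reachable x c
  rw [tieLiftTwo_reach_insert ω hcb]
  have hbb : (openGraph ω).Reachable b b := SimpleGraph.Reachable.refl _
  tauto

/-- Inserting `s(c, b)` with `c ∈ A` (`c ≠ b`): `o ↔ A` afterwards iff `o ↔ A` or `o ↔ b` before. [folklore] -/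
theorem tieLiftTwo_preimage_iUnion (A : Finset (Fin n)) (o b c : Fin n) (hc : c ∈ A) (hcb : c ≠ b) :
    (fun ω : BondConfig (Fin n) => insert s(c, b) ω) ⁻¹' (⋃ a ∈ A, (openConn o a : Set (BondConfig (Fin n)))) =
      (⋃ a ∈ A, (openConn o a : Set (BondConfig (Fin n)))) ∪ openConn o b := by
  ext ω
  simp only [Set.mem_preimage, Set.mem_union, Set.mem_iUnion, exists_prop]
  constructor
  · rintro ⟨a, ha, h⟩
    have h' : (openGraph (insert s(c, b) ω)).Reachable o a := h
    rw [tieLiftTwo_reach_insert ω hcb] at h'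
    rcases h' with h' | ⟨hoc | hob, -⟩
    · exact Or.inl ⟨a, ha, h'⟩
    · exact Or.inl ⟨c, hc, hoc⟩
    · exact Or.inr hob
  · rintro (⟨a, ha, h⟩ | h)
    · refine ⟨a, ha, ?_⟩
      show (openGraph (insert s(c, b) ω)).Reachable o a
      rw [tieLiftTwo_reach_insert ω hcb]
      exact Or.inl h
    · refine ⟨c, hc, ?_⟩
      show (openGraph (insert s(c, b) ω)).Reachable o c
      rw [tieLiftTwo_reach_insert ω hcb]
      exact Or.inr ⟨Or.inr h, Or.inl (SimpleGraph.Reachable.refl _)⟩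

/-! ### The two-relay inequality in E-form and the convexity step -/

/-- **Two tied relays, E-form** (Kozma–Nitzan arXiv:2401.12397 Thm 1 via the landed `stub_knThm1Set` with
observer set `{o}`): if `P(a₀ ↔ b) ≤ P(a₁ ↔ b)` then `P((o↔a₀ ∪ o↔a₁) ∖ o↔b) ≤ 1 − P(a₀ ↔ b)`.
[cite: KozmaNitzan2024, Theorem 1 (§3.1, inequality (3))] -/
theorem tieLiftTwo_Eform (v : Sym2 (Fin n) → unitInterval) (o b a₀ a₁ : Fin n)
    (htie : (prodBernoulli v).real (openConn a₀ b) ≤ (prodBernoulli v).real (openConn a₁ b)) :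
    (prodBernoulli v).real ((openConn o a₀ ∪ openConn o a₁) \ openConn o b) ≤
      1 - (prodBernoulli v).real (openConn a₀ b) := by
  have hkn := stub_knThm1Set n v {o} a₀ a₁ b
  rw [Finset.set_biUnion_singleton, Finset.set_biUnion_singleton] at hkn
  have hm : ∀ s : Set (BondConfig (Fin n)), MeasurableSet s := fun _ => MeasurableSet.of_discrete
  have h0 := measureReal_inter_add_sdiff (μ := prodBernoulli v)
    (s := (openConn o a₀ ∪ openConn o a₁ : Set (BondConfig (Fin n)))) (hm (openConn a₀ b))
  have h1 := measureReal_inter_add_sdiff (μ := prodBernoulli v)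
    (s := (openConn o a₀ ∪ openConn o a₁ : Set (BondConfig (Fin n)))) (hm (openConn a₁ b))
  have hB := measureReal_inter_add_sdiff (μ := prodBernoulli v)
    (s := (openConn o a₀ ∪ openConn o a₁ : Set (BondConfig (Fin n)))) (hm (openConn o b))
  have hc0 : (prodBernoulli v).real ((openConn o a₀ ∪ openConn o a₁) \ openConn a₀ b) ≤
      1 - (prodBernoulli v).real (openConn a₀ b) := by
    rw [← probReal_compl_eq_one_sub (hm _)]
    exact measureReal_mono fun ω hω => hω.2
  have hc1 : (prodBernoulli v).real ((openConn o a₀ ∪ openConn o a₁) \ openConn a₁ b) ≤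
      1 - (prodBernoulli v).real (openConn a₁ b) := by
    rw [← probReal_compl_eq_one_sub (hm _)]
    exact measureReal_mono fun ω hω => hω.2
  have hmin : (prodBernoulli v).real (openConn o a₀ ∪ openConn o a₁) -
      (1 - (prodBernoulli v).real (openConn a₀ b)) ≤
      min ((prodBernoulli v).real ((openConn o a₀ ∪ openConn o a₁) ∩ openConn a₀ b))
        ((prodBernoulli v).real ((openConn o a₀ ∪ openConn o a₁) ∩ openConn a₁ b)) :=
    le_min (by linarith) (by linarith)
  linarith

/-- **Convexity step of the joint lift.**  With `Ψ(v) := P_v(o ↔ A) − P_v(o ↔ b) − P_v(a₀ ↮ b)`,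
`a₀, a₁ ∈ A`, `a₀, a₁ ≠ b` and the tie `P_v(a₀ ↔ b) ≤ P_v(a₁ ↔ b)`:
`2 Ψ(v) ≤ Ψ(v[s(a₀,b) ↦ 1]) + Ψ(v[s(a₁,b) ↦ 1])`.  Opening `s(aᵢ, b)` turns `{o ↔ A}` into
`{o ↔ A} ∪ {o ↔ b}`, `{o ↔ b}` into `{o ↔ b} ∪ {o ↔ aᵢ}`, and `{a₀ ↔ b}` into `univ` resp.
`{a₀ ↔ b} ∪ {a₀ ↔ a₁}`; the claim is then `x₀ + x₁ ≤ f + g + 2u` (`xᵢ = P(o↔aᵢ, o↮b)`, `f = P(a₀↮b)`,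
`g = P(a₀↔a₁, a₀↮b)`, `u = P(o↔b, o↮A)`), which is the E-form plus `P(o↔a₀, o↔a₁, o↮b) ≤ g`. [folklore] -/
theorem tieLiftTwo_convex_step (v : Sym2 (Fin n) → unitInterval) (A : Finset (Fin n))
    (o b a₀ a₁ : Fin n) (h₀ : a₀ ∈ A) (h₁ : a₁ ∈ A) (hb₀ : a₀ ≠ b) (hb₁ : a₁ ≠ b)
    (htie : (prodBernoulli v).real (openConn a₀ b) ≤ (prodBernoulli v).real (openConn a₁ b)) :
    2 * ((prodBernoulli v).real (⋃ a ∈ A, openConn o a) - (prodBernoulli v).real (openConn o b) -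
          (1 - (prodBernoulli v).real (openConn a₀ b))) ≤
      ((prodBernoulli (Function.update v s(a₀, b) 1)).real (⋃ a ∈ A, openConn o a) -
          (prodBernoulli (Function.update v s(a₀, b) 1)).real (openConn o b) -
          (1 - (prodBernoulli (Function.update v s(a₀, b) 1)).real (openConn a₀ b))) +
        ((prodBernoulli (Function.update v s(a₁, b) 1)).real (⋃ a ∈ A, openConn o a) -
          (prodBernoulli (Function.update v s(a₁, b) 1)).real (openConn o b) -
          (1 - (prodBernoulli (Function.update v s(a₁, b) 1)).real (openConn a₀ b))) := by
  simp only [tieLiftTwo_real_update_one]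
  rw [tieLiftTwo_preimage_iUnion A o b a₀ h₀ hb₀, tieLiftTwo_preimage_iUnion A o b a₁ h₁ hb₁,
    tieLiftTwo_preimage_conn a₀ b o hb₀, tieLiftTwo_preimage_conn a₁ b o hb₁,
    tieLiftTwo_preimage_conn a₀ b a₀ hb₀, tieLiftTwo_preimage_conn a₁ b a₀ hb₁]
  have hm : ∀ s : Set (BondConfig (Fin n)), MeasurableSet s := fun _ => MeasurableSet.of_discrete
  have huniv : (openConn a₀ b ∪ openConn a₀ a₀ : Set (BondConfig (Fin n))) = univ :=
    Set.eq_univ_of_forall fun _ => Or.inr (SimpleGraph.Reachable.refl _)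
  rw [huniv, probReal_univ]
  have hU : ∀ s t : Set (BondConfig (Fin n)),
      (prodBernoulli v).real (s ∪ t) = (prodBernoulli v).real s + (prodBernoulli v).real (t \ s) := by
    intro s t
    rw [← Set.union_sdiff_self, measureReal_union Set.disjoint_sdiff_right (hm _)]
  rw [hU, hU, hU, hU]
  have hIE := measureReal_union_add_inter (μ := prodBernoulli v)
    (s := (openConn o a₀ \ openConn o b : Set (BondConfig (Fin n))))
    (t := (openConn o a₁ \ openConn o b : Set (BondConfig (Fin n)))) (hm _)
  rw [← Set.union_sdiff_distrib] at hIE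
  have hE := tieLiftTwo_Eform v o b a₀ a₁ htie
  have hgo : (prodBernoulli v).real ((openConn o a₀ \ openConn o b) ∩ (openConn o a₁ \ openConn o b)) ≤
      (prodBernoulli v).real (openConn a₀ a₁ \ openConn a₀ b) := by
    refine measureReal_mono ?_
    rintro ω ⟨⟨h0, hb⟩, h1, -⟩
    exact ⟨(SimpleGraph.Reachable.symm h0).trans h1,
      fun hab => hb ((show (openGraph ω).Reachable o a₀ from h0).trans hab)⟩
  have hnn : 0 ≤ (prodBernoulli v).real (openConn o b \ ⋃ a ∈ A, openConn o a) := measureReal_nonneg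
  linarith

/-! ### The tie is preserved along the lift, and `Ψ` is bi-affine -/

/-- **`F₀ − F₁` is linear along the joint lift**: with `ν = P_{w[s(a₀,b)↦0][s(a₁,b)↦0]}`,
`(1 − P_{w[s(a₀,b)↦p][s(a₁,b)↦q]}(a₀↔b)) − (1 − P_{w[s(a₀,b)↦p][s(a₁,b)↦q]}(a₁↔b))
 = (1−p)(1 − ν(a₀↔b ∪ a₀↔a₁)) − (1−q)(1 − ν(a₁↔b ∪ a₁↔a₀))`
(the `pq`-terms cancel because `{a₀↔a₁} ∖ {a₀↔b} = {a₁↔a₀} ∖ {a₁↔b}`). [folklore] -/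
theorem tieLiftTwo_tie_linear (w : Sym2 (Fin n) → unitInterval) {a₀ a₁ b : Fin n}
    (h01 : a₀ ≠ a₁) (hb₀ : a₀ ≠ b) (hb₁ : a₁ ≠ b) (p q : unitInterval) :
    (1 - (prodBernoulli (Function.update (Function.update w s(a₀, b) p) s(a₁, b) q)).real (openConn a₀ b)) -
      (1 - (prodBernoulli (Function.update (Function.update w s(a₀, b) p) s(a₁, b) q)).real (openConn a₁ b)) =
      (1 - (p : ℝ)) * (1 - (prodBernoulli (Function.update (Function.update w s(a₀, b) 0) s(a₁, b) 0)).real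
          (openConn a₀ b ∪ openConn a₀ a₁)) -
      (1 - (q : ℝ)) * (1 - (prodBernoulli (Function.update (Function.update w s(a₀, b) 0) s(a₁, b) 0)).real
          (openConn a₁ b ∪ openConn a₁ a₀)) := by
  have hne : s(a₀, b) ≠ s(a₁, b) := by
    rw [Ne, Sym2.congr_left]; exact h01
  rw [tieLiftTwo_twoBond_decomp w hne p q (openConn a₀ b), tieLiftTwo_twoBond_decomp w hne p q (openConn a₁ b)]
  have c10 : ∀ r : unitInterval,
      (prodBernoulli (Function.update (Function.update w s(a₀, b) 1) s(a₁, b) r)).real (openConn a₀ b) = 1 :=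
    fun r => tieLiftTwo_real_conn_eq_one _ hb₀ (by rw [Function.update_of_ne hne, Function.update_self])
  have c01 : ∀ r : unitInterval,
      (prodBernoulli (Function.update (Function.update w s(a₀, b) r) s(a₁, b) 1)).real (openConn a₁ b) = 1 :=
    fun r => tieLiftTwo_real_conn_eq_one _ hb₁ (by rw [Function.update_self])
  have d01 : (prodBernoulli (Function.update (Function.update w s(a₀, b) 0) s(a₁, b) 1)).real (openConn a₀ b) =
      (prodBernoulli (Function.update (Function.update w s(a₀, b) 0) s(a₁, b) 0)).real
        (openConn a₀ b ∪ openConn a₀ a₁) := by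
    have h : Function.update (Function.update w s(a₀, b) 0) s(a₁, b) 1 =
        Function.update (Function.update (Function.update w s(a₀, b) 0) s(a₁, b) 0) s(a₁, b) 1 := by
      rw [Function.update_idem]
    rw [h, tieLiftTwo_real_update_one, tieLiftTwo_preimage_conn a₁ b a₀ hb₁]
  have d10 : (prodBernoulli (Function.update (Function.update w s(a₀, b) 1) s(a₁, b) 0)).real (openConn a₁ b) =
      (prodBernoulli (Function.update (Function.update w s(a₀, b) 0) s(a₁, b) 0)).real
        (openConn a₁ b ∪ openConn a₁ a₀) := by
    have h : Function.update (Function.update w s(a₀, b) 1) s(a₁, b) 0 =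
        Function.update (Function.update (Function.update w s(a₀, b) 0) s(a₁, b) 0) s(a₀, b) 1 := by
      rw [Function.update_comm (Ne.symm hne), Function.update_idem]
    rw [h, tieLiftTwo_real_update_one, tieLiftTwo_preimage_conn a₀ b a₁ hb₀]
  rw [c10 0, c10 1, c01 0, c01 1, d01, d10]
  have hm : ∀ s : Set (BondConfig (Fin n)), MeasurableSet s := fun _ => MeasurableSet.of_discrete
  have hg0 : (prodBernoulli (Function.update (Function.update w s(a₀, b) 0) s(a₁, b) 0)).real
        (openConn a₀ b ∪ openConn a₀ a₁) =
      (prodBernoulli (Function.update (Function.update w s(a₀, b) 0) s(a₁, b) 0)).real (openConn a₀ b) +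
      (prodBernoulli (Function.update (Function.update w s(a₀, b) 0) s(a₁, b) 0)).real
        (openConn a₀ a₁ \ openConn a₀ b) := by
    rw [← Set.union_sdiff_self, measureReal_union Set.disjoint_sdiff_right (hm _)]
  have hset : (openConn a₁ a₀ \ openConn a₁ b : Set (BondConfig (Fin n))) = openConn a₀ a₁ \ openConn a₀ b := by
    ext ω
    constructor
    · rintro ⟨h10, h1b⟩
      exact ⟨SimpleGraph.Reachable.symm h10,
        fun h0b => h1b ((show (openGraph ω).Reachable a₁ a₀ from h10).trans h0b)⟩
    · rintro ⟨h01', h0b⟩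
      exact ⟨SimpleGraph.Reachable.symm h01',
        fun h1b => h0b ((show (openGraph ω).Reachable a₀ a₁ from h01').trans h1b)⟩
  have hg1 : (prodBernoulli (Function.update (Function.update w s(a₀, b) 0) s(a₁, b) 0)).real
        (openConn a₁ b ∪ openConn a₁ a₀) =
      (prodBernoulli (Function.update (Function.update w s(a₀, b) 0) s(a₁, b) 0)).real (openConn a₁ b) +
      (prodBernoulli (Function.update (Function.update w s(a₀, b) 0) s(a₁, b) 0)).real
        (openConn a₀ a₁ \ openConn a₀ b) := by
    rw [← Set.union_sdiff_self, measureReal_union Set.disjoint_sdiff_right (hm _), hset]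
  rw [hg0, hg1]
  ring

/-- **`Ψ` is bi-affine along the lift**: with `Ψ(v) := P_v(o ↔ A) − P_v(o ↔ b) − (1 − P_v(a₀ ↔ b))` and
`W(p, q) := w[e₀↦p][e₁↦q]` (`e₀ ≠ e₁`), `Ψ(W(p,q)) = Σ_{i,j} cᵢⱼ(p,q) Ψ(W(i,j))` with the bi-affine weights
`c₀₀ = (1−p)(1−q)`, `c₁₀ = p(1−q)`, `c₀₁ = (1−p)q`, `c₁₁ = pq`. [folklore] -/
theorem tieLiftTwo_psi_decomp (w : Sym2 (Fin n) → unitInterval) {e₀ e₁ : Sym2 (Fin n)} (hne : e₀ ≠ e₁)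
    (SA SB S0 : Set (BondConfig (Fin n))) (p q : unitInterval) :
    (prodBernoulli (Function.update (Function.update w e₀ p) e₁ q)).real SA -
        (prodBernoulli (Function.update (Function.update w e₀ p) e₁ q)).real SB -
        (1 - (prodBernoulli (Function.update (Function.update w e₀ p) e₁ q)).real S0) =
      (1 - (p : ℝ)) * (1 - (q : ℝ)) *
          ((prodBernoulli (Function.update (Function.update w e₀ 0) e₁ 0)).real SA -
            (prodBernoulli (Function.update (Function.update w e₀ 0) e₁ 0)).real SB -
            (1 - (prodBernoulli (Function.update (Function.update w e₀ 0) e₁ 0)).real S0)) +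
        (p : ℝ) * (1 - (q : ℝ)) *
          ((prodBernoulli (Function.update (Function.update w e₀ 1) e₁ 0)).real SA -
            (prodBernoulli (Function.update (Function.update w e₀ 1) e₁ 0)).real SB -
            (1 - (prodBernoulli (Function.update (Function.update w e₀ 1) e₁ 0)).real S0)) +
        (1 - (p : ℝ)) * (q : ℝ) *
          ((prodBernoulli (Function.update (Function.update w e₀ 0) e₁ 1)).real SA -
            (prodBernoulli (Function.update (Function.update w e₀ 0) e₁ 1)).real SB -
            (1 - (prodBernoulli (Function.update (Function.update w e₀ 0) e₁ 1)).real S0)) +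
        (p : ℝ) * (q : ℝ) *
          ((prodBernoulli (Function.update (Function.update w e₀ 1) e₁ 1)).real SA -
            (prodBernoulli (Function.update (Function.update w e₀ 1) e₁ 1)).real SB -
            (1 - (prodBernoulli (Function.update (Function.update w e₀ 1) e₁ 1)).real S0)) := by
  rw [tieLiftTwo_twoBond_decomp w hne p q SA, tieLiftTwo_twoBond_decomp w hne p q SB,
    tieLiftTwo_twoBond_decomp w hne p q S0]
  ring

/-- **Registered helper stub `stub_tieLiftTwoConvex`** (crux stmt-CriticalPhenomena-4576, line
replica-splice-at-entrance): the convexity step of the joint lift, `2 Ψ(v) ≤ Ψ(v[s(a₀,b)↦1]) + Ψ(v[s(a₁,b)↦1])`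
for tied relays — `tieLiftTwo_convex_step` with all binders explicit. [folklore] -/
theorem stub_tieLiftTwoConvex :
    ∀ (n : ℕ) (v : Sym2 (Fin n) → unitInterval) (A : Finset (Fin n)) (o b a₀ a₁ : Fin n), a₀ ∈ A → a₁ ∈ A → a₀ ≠ b → a₁ ≠ b → (prodBernoulli v).real (openConn a₀ b) ≤ (prodBernoulli v).real (openConn a₁ b) → 2 * ((prodBernoulli v).real (⋃ a ∈ A, openConn o a) - (prodBernoulli v).real (openConn o b) - (1 - (prodBernoulli v).real (openConn a₀ b))) ≤ ((prodBernoulli (Function.update v s(a₀, b) 1)).real (⋃ a ∈ A, openConn o a) - (prodBernoulli (Function.update v s(a₀, b) 1)).real (openConn o b) - (1 - (prodBernoulli (Function.update v s(a₀, b) 1)).real (openConn a₀ b))) + ((prodBernoulli (Function.update v s(a₁, b) 1)).real (⋃ a ∈ A, openConn o a) - (prodBernoulli (Function.update v s(a₁, b) 1)).real (openConn o b) - (1 - (prodBernoulli (Function.update v s(a₁, b) 1)).real (openConn a₀ b))) :=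
  fun _ v A o b a₀ a₁ h₀ h₁ hb₀ hb₁ htie => tieLiftTwo_convex_step v A o b a₀ a₁ h₀ h₁ hb₀ hb₁ htie

end

end Summit.CriticalPhenomena.PercolationContinuityZ3.Theorems
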